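import Literature.MathematicalPhysics.QuantumLattice.SpinFlipTwist
import Literature.MathematicalPhysics.QuantumLattice.InfiniteVolumeShiftProofs
import HarnessLib

/-!
# Twisting the exchange operator: the Lieb–Schultz–Mattis bond identity, and twists under
# isotony and translations

Trunk **T-QLATTICE**. Proof file behind the named fact
`Literature.MathematicalPhysics.QuantumLattice.no_unique_gapped_groundState_halfOddSpin`
(`InfiniteVolume.lean`), continuing `SpinFlipTwist.lean` (the diagonal twists
`U_θ = exp[-i Σ_x θ_x (Ŝᶻ_x + S)]`). Contents:

* `conjTranspose_twistOp_conj_spinDot_add` — **the bond identity of the Lieb–Schultz–Mattis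
  variational estimate** (Tasaki 2022, proof of Lemma 3.1, the display computing
  `Ûᴴ ĥ_j Û + Û ĥ_j Ûᴴ - 2ĥ_j`): for the exchange operator `ĥ = 𝐒_x·𝐒_y` (`x ≠ y`) and any angles,
  `U_θᴴ ĥ U_θ + U_θ ĥ U_θᴴ - 2ĥ = 2(cos(θ_x - θ_y) - 1)(Sˣ_xSˣ_y + Sʸ_xSʸ_y)`
  — from the product-basis entries of `𝐒_x·𝐒_y` (`spinDot_apply_of_ne`, the selection rule
  `spinDot_apply_ne_zero`: a nonzero entry moves one unit of `Sᶻ` between `x` and `y` or is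
  diagonal) and the twisted entries `e^{±i(φ_σ - φ_τ)} ĥ_{στ}` (`SpinFlipTwist`);
* `twistOp_eq_one_of_int` — angles in `2πℤ` act trivially (`exp[-i2π(Ŝᶻ + S)] = 1`, the identity
  making the local twist continuous/local, Tasaki 2022 §3.1);
* `embedOp_twistOp`, `transportOp_twistOp` — isotony extends the angles by `0`, translations
  shift them; and the bookkeeping `embedOp_onSite`, `embedOp_spinBond`, `embedOp_spinDot`,
  `transportOp_spinBond` for the bond operators.

No statement of any other file is changed and no definition is introduced.

## References

* H. Tasaki, *The Lieb–Schultz–Mattis theorem. A topological point of view*, in: The Physics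
  and Mathematics of Elliott Lieb, vol. 2, EMS Press (2022) 405–446, arXiv:2202.06243 (held),
  §3.1, Lemma 3.1 and its proof (the bond identity
  `Ûᴴĥ_jÛ + Ûĥ_jÛᴴ - 2ĥ_j = 2J{cos(θ_j - θ_{j+1}) - 1}(ŜˣŜˣ + ŜʸŜʸ)`), and the local twist
  operator (`exp[-i2π(Ŝᶻ_j + S)] = 1`). [Tasaki2022]
* E. Lieb, T. Schultz, D. Mattis, *Two soluble models of an antiferromagnetic chain*,
  Ann. Phys. 16 (1961) 407–466, Appendix B (the twist estimate) — as cited by Tasaki (2022).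
  [Tasaki2022]
-/

noncomputable section

open Matrix Complex Finset

namespace Literature.MathematicalPhysics.QuantumLattice

open Literature.Probability.LatticeModels
open Literature.Probability.LatticeModels (Site)

/-! ### Bond operators under isotony and translations -/

section Embed

variable {Λ : Type*} [DecidableEq Λ] {q : ℕ} (n : ℕ)

/-- Isotony maps single-site operators to single-site operators: `(a_x) ⊗ 𝟙 = a_x`.
Bratteli–Robinson II §6.2.1. [folklore] -/
theorem embedOp_onSite {X Y : Finset Λ} (h : X ⊆ Y) (x : ↥X) (a : Matrix (Fin q) (Fin q) ℂ) :
    embedOp h (onSite x a) = onSite (⟨x, h x.2⟩ : ↥Y) a := by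
  ext σ τ
  simp only [embedOp, of_apply, onSite_apply]
  by_cases hc : ∀ z : ↥Y, z ≠ ⟨x, h x.2⟩ → σ z = τ z
  · have h1 : ∀ z : ↥Y, (z : Λ) ∉ X → σ z = τ z := fun z hz =>
      hc z fun heq => hz (by rw [heq]; exact x.2)
    have h2 : ∀ z : ↥X, z ≠ x → σ ⟨z, h z.2⟩ = τ ⟨z, h z.2⟩ := fun z hz =>
      hc ⟨z, h z.2⟩ fun heq => hz (Subtype.ext (congrArg (fun w : ↥Y => (w : Λ)) heq))
    rw [if_pos hc, if_pos h1, if_pos h2]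
  · rw [if_neg hc]
    split_ifs with h₁ h₂
    · exfalso
      refine hc fun z hz => ?_
      by_cases hzX : (z : Λ) ∈ X
      · exact h₂ ⟨z, hzX⟩ fun heq => hz (Subtype.ext (congrArg (fun w : ↥X => (w : Λ)) heq))
      · exact h₁ z hzX
    · rfl
    · rfl


/-- Isotony on site spins: `S^α_x ⊗ 𝟙 = S^α_x`. Bratteli–Robinson II §6.2.1. [folklore] -/
theorem embedOp_siteSpin {X Y : Finset Λ} (h : X ⊆ Y) (x : ↥X) (α : Fin 3) :
    embedOp h (siteSpin n x α) = siteSpin n (⟨x, h x.2⟩ : ↥Y) α :=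
  embedOp_onSite h x _

end Embed

section EmbedSite

variable {d : ℕ} (n : ℕ)

/-- Isotony on bond operators: `(½(S^α_xS^α_y + S^α_yS^α_x)) ⊗ 𝟙` is the same bond operator in the
larger region. Bratteli–Robinson II §6.2.1. [folklore] -/
theorem embedOp_spinBond {X Y : Finset (Site d)} (h : X ⊆ Y) (α : Fin 3) (x y : ↥X) :
    embedOp h (spinBond n α x y) = spinBond n α (⟨x, h x.2⟩ : ↥Y) ⟨y, h y.2⟩ := by
  simp only [spinBond, embedOp_smul, embedOp_add, embedOp_mul, embedOp_siteSpin]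

/-- Isotony on the exchange operator: `(𝐒_x·𝐒_y) ⊗ 𝟙 = 𝐒_x·𝐒_y`. Bratteli–Robinson II §6.2.1.
[folklore] -/
theorem embedOp_spinDot {X Y : Finset (Site d)} (h : X ⊆ Y) (x y : ↥X) :
    embedOp h (spinDot n x y) = spinDot n (⟨x, h x.2⟩ : ↥Y) ⟨y, h y.2⟩ := by
  simp only [spinDot, embedOp_sum, embedOp_spinBond]

/-- Translations move bond operators: `τ_e (½(S^α_xS^α_y + S^α_yS^α_x)) = ½(S^α_{ex}S^α_{ey} + …)`.
Bratteli–Robinson II §6.2.1. [folklore] -/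
theorem transportOp_spinBond {X Y : Type*} [Fintype X] [DecidableEq X] [Fintype Y] [DecidableEq Y]
    (e : X ≃ Y) (α : Fin 3) (x y : X) :
    transportOp e (spinBond n α x y) = spinBond n α (e x) (e y) := by
  simp only [transportOp_eq_reindexAlgEquiv, spinBond, siteSpin, map_smul, map_add, map_mul]
  simp only [← transportOp_eq_reindexAlgEquiv, transportOp_onSite]

end EmbedSite

/-! ### Twists under isotony and translations; trivial angles -/

section TwistPlumbing

variable {q : ℕ}

/-- **Angles in `2πℤ` act trivially**: if every `θ_x ∈ 2πℤ` then `U_θ = 𝟙` (the generators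
`Ŝᶻ_x + S` have integer spectrum; this is `exp[-i2π(Ŝᶻ_j + S)] = 1`, the identity behind the
locality and continuity of the local twist operator in Tasaki 2022 §3.1).
[cite: Tasaki2022, §3.1 (local twist operator Û_{x,ℓ})] -/
theorem twistOp_eq_one_of_int {Λ : Type*} [Fintype Λ] [DecidableEq Λ] {θ : Λ → ℝ}
    (hθ : ∀ x, ∃ m : ℤ, θ x = 2 * Real.pi * m) : (twistOp θ : Op Λ q) = 1 := by
  choose m hm using hθ
  rw [twistOp, ← diagonal_one]
  congr 1
  funext σ
  have hphase : (twistPhase θ σ : ℂ) = ((∑ x, m x * ((σ x).rev : ℕ) : ℤ) : ℂ) * (2 * Real.pi) := by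
    simp only [twistPhase, hm]
    push_cast
    rw [Finset.sum_mul]
    refine Finset.sum_congr rfl fun x _ => ?_
    ring
  rw [hphase, show -(I * (((∑ x, m x * ((σ x).rev : ℕ) : ℤ) : ℂ) * (2 * Real.pi))) =
      ((-(∑ x, m x * ((σ x).rev : ℕ) : ℤ) : ℤ) : ℂ) * (2 * Real.pi * I) by push_cast; ring]
  exact Complex.exp_int_mul_two_pi_mul_I _

/-- **Isotony extends the angles by zero**: `U_θ ⊗ 𝟙_{Λ'∖Λ} = U_{θ'}` with `θ' = θ` on `Λ` and
`θ' = 0` off `Λ` (the twist acts as the identity where the angle vanishes).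
Tasaki (2022) §3.1 (the local twist is a local operator). [folklore] -/
theorem embedOp_twistOp {Λt : Type*} [DecidableEq Λt] {Λ Λ' : Finset Λt} (h : Λ ⊆ Λ')
    (θ : ↥Λ → ℝ) :
    embedOp h (twistOp θ : Op ↥Λ q) =
      twistOp fun y : ↥Λ' => if hy : (y : Λt) ∈ Λ then θ ⟨y, hy⟩ else 0 := by
  ext σ τ
  have hphase : twistPhase (fun y : ↥Λ' => if hy : (y : Λt) ∈ Λ then θ ⟨y, hy⟩ else 0) σ =
      twistPhase θ fun x : ↥Λ => σ ⟨x, h x.2⟩ := by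
    simp only [twistPhase]
    let ι : ↥Λ ↪ ↥Λ' :=
      ⟨fun x => ⟨x, h x.2⟩, fun a b hab => Subtype.ext (congrArg (fun w : ↥Λ' => (w : Λt)) hab)⟩
    rw [← Finset.sum_subset (Finset.subset_univ (Finset.univ.map ι)), Finset.sum_map]
    · refine Finset.sum_congr rfl fun x _ => ?_
      simp [ι]
    · intro y _ hy
      have hy' : (y : Λt) ∉ Λ := fun hyΛ =>
        hy (Finset.mem_map.2 ⟨⟨y, hyΛ⟩, Finset.mem_univ _, Subtype.ext rfl⟩)
      rw [dif_neg hy', zero_mul]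
  rw [embedOp, of_apply, twistOp_apply, twistOp_apply, hphase]
  by_cases hστ : σ = τ
  · subst hστ
    rw [if_pos fun _ _ => rfl, if_pos rfl, if_pos rfl]
  · rw [if_neg hστ]
    split_ifs with h₁ h₂
    · exact (hστ (funext fun y => if hy : (y : Λt) ∈ Λ then congrFun h₂ ⟨y, hy⟩ else h₁ y hy)).elim
    · rfl
    · rfl

/-- **Translations shift the angles**: `τ_e (U_θ) = U_{θ ∘ e⁻¹}`. Tasaki (2022) §3.2
(`Û_{x,ℓ}` and its translate). [folklore] -/
theorem transportOp_twistOp {X Y : Type*} [Fintype X] [DecidableEq X] [Fintype Y] [DecidableEq Y]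
    (e : X ≃ Y) (θ : X → ℝ) :
    transportOp e (twistOp θ : Op X q) = twistOp fun y => θ (e.symm y) := by
  ext σ τ
  rw [transportOp_apply, twistOp_apply, twistOp_apply]
  have hc : ((fun x => σ (e x)) = fun x => τ (e x)) ↔ σ = τ :=
    ⟨fun hst => funext fun y => by simpa using congrFun hst (e.symm y),
      fun hst => by rw [hst]⟩
  have hphase : twistPhase θ (fun x => σ (e x)) = twistPhase (fun y => θ (e.symm y)) σ := by
    simp only [twistPhase]
    exact (e.sum_comp (fun y => θ (e.symm y) * (((σ y).rev : ℕ) : ℝ))).symm.trans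
      (by simp) |>.symm
  rw [if_congr hc rfl rfl, hphase]

end TwistPlumbing

/-! ### The Lieb–Schultz–Mattis bond identity -/

section BondIdentity

variable {X : Type*} [Fintype X] [DecidableEq X] (n : ℕ)

omit [DecidableEq X] in
/-- The difference of twist phases of two configurations agreeing off `{x, y}` only involves the
sites `x` and `y`: `φ_θ(σ) - φ_θ(τ) = θ_x (rev σ_x - rev τ_x) + θ_y (rev σ_y - rev τ_y)`. [folklore] -/
theorem twistPhase_sub_of_agree (θ : X → ℝ) {x y : X} (hxy : x ≠ y) {σ τ : TensorIndex X (n + 1)}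
    (hag : ∀ z, z ≠ x → z ≠ y → σ z = τ z) :
    twistPhase θ σ - twistPhase θ τ =
      θ x * ((((σ x).rev : ℕ) : ℝ) - (((τ x).rev : ℕ) : ℝ)) +
        θ y * ((((σ y).rev : ℕ) : ℝ) - (((τ y).rev : ℕ) : ℝ)) := by
  simp only [twistPhase, ← Finset.sum_sub_distrib, ← mul_sub]
  rw [Finset.sum_eq_add x y hxy]
  · intro z _ hz
    rw [hag z hz.1 hz.2, sub_self, mul_zero]
  · intro h; exact absurd (Finset.mem_univ x) h
  · intro h; exact absurd (Finset.mem_univ y) h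

/-- **The Lieb–Schultz–Mattis bond identity.** For the exchange operator `ĥ = 𝐒_x·𝐒_y` (`x ≠ y`)
and a diagonal twist `U = U_θ = exp[-i Σ_z θ_z (Ŝᶻ_z + S)]`,
`Uᴴ ĥ U + U ĥ Uᴴ - 2ĥ = 2 (cos(θ_x - θ_y) - 1) (Sˣ_x Sˣ_y + Sʸ_x Sʸ_y)`:
the `Sᶻ_xSᶻ_y` part commutes with the twist, and the flip-flop part `½(S⁺_xS⁻_y + S⁻_xS⁺_y)`
picks up the phases `e^{±i(θ_x - θ_y)}`, whose symmetrisation is `2cos(θ_x - θ_y)`. This is the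
display `Ûᴴĥ_jÛ + Ûĥ_jÛᴴ - 2ĥ_j = 2J{cos(θ_j - θ_{j+1}) - 1}(Ŝˣ_jŜˣ_{j+1} + Ŝʸ_jŜʸ_{j+1})` in the
proof of Tasaki (2022), Lemma 3.1 (here with `J = 1`; entrywise from `spinDot_apply_of_ne` and the
selection rule `spinDot_apply_ne_zero`). [cite: Tasaki2022, §3.1 Lemma 3.1 (proof)] -/
theorem conjTranspose_twistOp_conj_spinDot_add (θ : X → ℝ) {x y : X} (hxy : x ≠ y) :
    (twistOp θ)ᴴ * spinDot n x y * twistOp θ + twistOp θ * spinDot n x y * (twistOp θ)ᴴ -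
        2 • spinDot n x y =
      ((2 * Real.cos (θ x - θ y) - 2 : ℝ) : ℂ) • (spinBond n 0 x y + spinBond n 1 x y) := by
  ext σ τ
  rw [Matrix.sub_apply, Matrix.add_apply, conjTranspose_twistOp_mul_mul_twistOp_apply,
    twistOp_mul_mul_conjTranspose_twistOp_apply, Matrix.smul_apply, Matrix.smul_apply,
    Matrix.add_apply, spinBond_apply_of_ne n 0 hxy, spinBond_apply_of_ne n 1 hxy, smul_eq_mul,
    nsmul_eq_mul, Nat.cast_ofNat]
  by_cases hag : ∀ z, z ≠ x → z ≠ y → σ z = τ z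
  · rw [if_pos hag, if_pos hag, spinVec_zero, spinVec_one, spinX_mul_spinX_add_spinY_mul_spinY,
      spinDot_apply_of_ne n hxy, if_pos hag]
    set hop := 1 / 2 * (spinRaise n (σ x) (τ x) * spinLower n (σ y) (τ y) +
      spinLower n (σ x) (τ x) * spinRaise n (σ y) (τ y)) with hhop
    set zz := SpinOperators.spinZ n (σ x) (τ x) * SpinOperators.spinZ n (σ y) (τ y) with hzz
    by_cases hz : zz = 0
    · rw [hz, add_zero]
      by_cases hh : hop = 0
      · rw [hh]; ring
      · -- a hopping entry: the phases are `e^{±i(θ_x - θ_y)}`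
        have hsel := spinDot_apply_ne_zero n hxy (σ := σ) (τ := τ)
          (by rw [spinDot_apply_of_ne n hxy, if_pos hag, ← hhop, ← hzz, hz, add_zero]; exact hh)
        have hΔ : twistPhase θ σ - twistPhase θ τ = θ x - θ y ∨
            twistPhase θ σ - twistPhase θ τ = -(θ x - θ y) := by
          rw [twistPhase_sub_of_agree n θ hxy hag]
          simp only [natCast_val_rev_real]
          rcases hsel.2 with ⟨h1, h2⟩ | ⟨h1, h2⟩ | ⟨h1, h2⟩
          · exfalso
            apply hh
            have hR : spinRaise n (σ x) (τ x) = 0 := by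
              rw [spinRaise_apply, if_neg]; rw [h1]; omega
            have hL : spinLower n (σ x) (τ x) = 0 := by
              rw [spinLower_eq_conjTranspose, conjTranspose_apply, spinRaise_apply, if_neg,
                star_zero]; rw [h1]; omega
            rw [hhop, hR, hL]; ring
          · left
            have e1 : ((τ x : ℕ) : ℝ) = (σ x : ℕ) + 1 := by exact_mod_cast h1
            have e2 : ((σ y : ℕ) : ℝ) = (τ y : ℕ) + 1 := by exact_mod_cast h2
            rw [e1, e2]; ring
          · right
            have e1 : ((σ x : ℕ) : ℝ) = (τ x : ℕ) + 1 := by exact_mod_cast h1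
            have e2 : ((τ y : ℕ) : ℝ) = (σ y : ℕ) + 1 := by exact_mod_cast h2
            rw [e1, e2]; ring
        have hcos : Complex.exp (I * ((twistPhase θ σ : ℂ) - twistPhase θ τ)) +
            Complex.exp (-(I * ((twistPhase θ σ : ℂ) - twistPhase θ τ))) =
            (2 * Real.cos (θ x - θ y) : ℝ) := by
          rw [← Complex.ofReal_sub]
          rcases hΔ with hΔ | hΔ <;> rw [hΔ]
          · push_cast
            rw [Complex.two_cos]; ring_nf
          · push_cast
            rw [← Complex.cos_neg, Complex.two_cos]; ring_nf
        calc _ = (Complex.exp (I * ((twistPhase θ σ : ℂ) - twistPhase θ τ)) +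
              Complex.exp (-(I * ((twistPhase θ σ : ℂ) - twistPhase θ τ)))) * hop - 2 * hop := by
              ring
          _ = _ := by rw [hcos]; push_cast; ring
    · -- a diagonal entry: `σ = τ`, no phase, and no flip-flop amplitude
      have hx : σ x = τ x := spinZ_apply_ne_zero n (left_ne_zero_of_mul hz)
      have hy : σ y = τ y := spinZ_apply_ne_zero n (right_ne_zero_of_mul hz)
      have hστ : σ = τ := funext fun z => by
        by_cases hzx : z = x
        · rw [hzx, hx]
        · by_cases hzy : z = y
          · rw [hzy, hy]
          · exact hag z hzx hzy
      subst hστ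
      have hh : hop = 0 := by
        have hR : spinRaise n (σ x) (σ x) = 0 := by rw [spinRaise_apply, if_neg]; omega
        have hL : spinLower n (σ x) (σ x) = 0 := by
          rw [spinLower_eq_conjTranspose, conjTranspose_apply, hR, star_zero]
        rw [hhop, hR, hL]; ring
      rw [hh, sub_self, mul_zero, neg_zero, Complex.exp_zero]
      ring
  · rw [if_neg hag, if_neg hag, spinDot_apply_of_ne n hxy, if_neg hag]
    simp

end BondIdentity

end Literature.MathematicalPhysics.QuantumLattice
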